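import Summits.QuantumAdvantage.QuantumAdvantage.Theorems.CubicForrelationNearExactIsExactCubicFormSymplecticCoords
import Summits.QuantumAdvantage.QuantumAdvantage.Theorems.CubicForrelationNearExactIsExactCubicFormSymplectic
import Summits.QuantumAdvantage.QuantumAdvantage.Theorems.CubicForrelationNearExactIsExactCubicFormFrameK
import Summits.QuantumAdvantage.QuantumAdvantage.Theorems.CubicForrelationNearExactIsExactTwelvePartnerSymplectic

/-!
# Crux `CubicForrelation.NearExactIsExact` (stmt-QuantumAdvantage-14043) — E1280-even, R4 branch, the d-level leaf of descendant `0`: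
  SYMPLECTIC COORDINATES for the alternating matrix `Ξ`

Certificate seat `b2b-cforr-cert` (gen 43).  HONEST FRAMING: kernel-checked linear algebra over `𝔽₂` (standard axioms), tool 3 for the
leaf statement `HLEAF` of …CubicFormR4ZReduce, assembled from the tree's frame pipeline: a maximal symplectic frame of the form
`x, y ↦ xᵀ Ξ y` (…CubicFormSymplectic `tcs_frame_exists`), its expansion `Ξ = Σᵢ pᵢ ∧ qᵢ` (…CubicFormSymplecticCoords
`tsc_form_expansion`, `tsc_additive_parity`), the bound `2h ≤ 7` (…CubicFormFrameK `tcg_le_of_dual`) and coordinates in which the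
`2h` forms are coordinate forms (`tcg_adapted_frame_le`).  RESULT `tq5_xi_frame`: for a symmetric `Ξ ∈ 𝔽₂^{7×7}` with zero diagonal
there are `h ≤ 3` and an inverse pair `R, Ri` with `(Rᵀ Ξ R)_{su} = Σ_{i<h} ([s = i][u = h+i] + [s = h+i][u = i])` — the `z`-block of
the frame that puts the leaf's cubic form into the normal form of …TwelvePartnerR4LeafZ (`rank Ξ = 2h`, `rad Ξ` = the last `7 − 2h`
coordinates).  Nothing about `θ₁₂`; NOT summit progress.

References: L. E. Dickson (1901); F. J. MacWilliams, N. J. A. Sloane (1977) Ch. 15 §2 Thm 4.  Axioms: the standard three.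
-/

set_option linter.dupNamespace false -- D-0017: single-problem summit ⇒ `QuantumAdvantage.QuantumAdvantage` by design

namespace Summit.QuantumAdvantage.QuantumAdvantage.Theorems.CubicForrelation.NearExactIsExact

open Finset
open Literature.Computability.QuantumComplexity.BuzetChailloux (bxor)

/-- **Symplectic coordinates for `Ξ`.**  See the module docstring. [folklore; cite: MacWilliamsSloane1977, Ch. 15 §2 Thm 4] -/
theorem tq5_xi_frame (Ξ : Fin 7 → Fin 7 → ZMod 2) (hΞs : ∀ j k, Ξ k j = Ξ j k) (hΞd : ∀ j, Ξ j j = 0) :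
    ∃ h : ℕ, h ≤ 3 ∧ ∃ R Ri : Fin 7 → Fin 7 → ZMod 2,
      (∀ j k, (∑ s, R j s * Ri s k) = if j = k then 1 else 0) ∧ (∀ j k, (∑ s, Ri j s * R s k) = if j = k then 1 else 0) ∧
      (∀ s u : Fin 7, (∑ m, ∑ m', Ξ m m' * R m s * R m' u) =
        ∑ i : Fin h, ((if s.val = i.val then (1 : ZMod 2) else 0) * (if u.val = h + i.val then (1 : ZMod 2) else 0) +
          (if s.val = h + i.val then (1 : ZMod 2) else 0) * (if u.val = i.val then (1 : ZMod 2) else 0))) := by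
  classical
  -- the form `xᵀ Ξ y` as a Boolean function of bit vectors
  set BX : (Fin 7 → Bool) → (Fin 7 → Bool) → Bool := fun x y =>
    decide ((∑ m, ∑ m', Ξ m m' * (if x m = true then (1 : ZMod 2) else 0) * (if y m' = true then (1 : ZMod 2) else 0)) = 1) with hBX
  have hS : ∀ x y : Fin 7 → Bool, (∑ m, ∑ m', Ξ m m' * (if x m = true then (1 : ZMod 2) else 0) * (if y m' = true then (1 : ZMod 2) else 0)) =
      ∑ m, ∑ m', Ξ m m' * (if y m = true then (1 : ZMod 2) else 0) * (if x m' = true then (1 : ZMod 2) else 0) := by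
    intro x y
    rw [Finset.sum_comm]
    exact sum_congr rfl fun i _ => sum_congr rfl fun j _ => by rw [hΞs i j]; ring
  have hsymm : ∀ x y, BX x y = BX y x := by
    intro x y; simp only [hBX, hS x y]
  have hι : ∀ β γ : Bool, (if (β ^^ γ) = true then (1 : ZMod 2) else 0) = (if β = true then (1 : ZMod 2) else 0) + (if γ = true then (1 : ZMod 2) else 0) := by decide
  have hdec : ∀ A B : ZMod 2, decide (A + B = 1) = (decide (A = 1) ^^ decide (B = 1)) := by decide
  have hadd : ∀ x y w, BX (bxor x y) w = (BX x w ^^ BX y w) := by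
    intro x y w
    have e : (∑ m, ∑ m', Ξ m m' * (if (bxor x y) m = true then (1 : ZMod 2) else 0) * (if w m' = true then (1 : ZMod 2) else 0)) =
        (∑ m, ∑ m', Ξ m m' * (if x m = true then (1 : ZMod 2) else 0) * (if w m' = true then (1 : ZMod 2) else 0)) + ∑ m, ∑ m', Ξ m m' * (if y m = true then (1 : ZMod 2) else 0) * (if w m' = true then (1 : ZMod 2) else 0) := by
      rw [← sum_add_distrib]
      refine sum_congr rfl fun m _ => ?_
      rw [← sum_add_distrib]
      refine sum_congr rfl fun m' _ => ?_
      have hb : bxor x y m = (x m ^^ y m) := rfl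
      rw [hb, hι]; ring
    simp only [hBX, e, hdec]
  have halt : ∀ x, BX x x = false := by
    intro x
    have h0 : (∑ m, ∑ m', Ξ m m' * (if x m = true then (1 : ZMod 2) else 0) * (if x m' = true then (1 : ZMod 2) else 0)) = 0 := by
      have e := tps_conj_diag_zero (Matrix.of fun i j => Ξ i j) (Matrix.of fun a (_ : Fin 7) => (if x a = true then (1 : ZMod 2) else 0))
        (fun i j => by rw [Matrix.of_apply, Matrix.of_apply]; exact hΞs i j) (fun i => by rw [Matrix.of_apply]; exact hΞd i) 0
      simp only [Matrix.mul_apply, Matrix.transpose_apply, Matrix.of_apply, Finset.sum_mul] at e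
      rw [Finset.sum_comm] at e
      refine Eq.trans (sum_congr rfl fun m _ => sum_congr rfl fun m' _ => ?_) e
      ring
    simp only [hBX, h0]; decide
  -- a maximal symplectic frame
  obtain ⟨h, b, c, hbc, hbc', hbb, hcc, hmax⟩ := tcs_frame_exists BX hsymm halt
  -- its `2h` parity forms `BX(·, cᵢ)`, `BX(·, bᵢ)` with the dual family `bᵢ`, `cᵢ`
  set zf : Fin (h + h) → (Fin 7 → Bool) :=
    Fin.append (fun i l => BX (fun l' => decide (l' = l)) (c i)) (fun i l => BX (fun l' => decide (l' = l)) (b i)) with hzf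
  set uf : Fin (h + h) → (Fin 7 → Bool) := Fin.append b c with huf
  have hpc : ∀ (x : Fin 7 → Bool) (i : Fin h), decide (Odd #(univ.filter fun j => x j && zf (Fin.castAdd h i) j)) = BX x (c i) := by
    intro x i
    have e := (tsc_additive_parity (fun x => BX x (c i)) (fun u u' => hadd u u' (c i)) x).symm
    beta_reduce at e
    rw [hzf, Fin.append_left]
    exact e
  have hpb : ∀ (x : Fin 7 → Bool) (i : Fin h), decide (Odd #(univ.filter fun j => x j && zf (Fin.natAdd h i) j)) = BX x (b i) := by
    intro x i
    have e := (tsc_additive_parity (fun x => BX x (b i)) (fun u u' => hadd u u' (b i)) x).symm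
    beta_reduce at e
    rw [hzf, Fin.append_right]
    exact e
  have hcn : ∀ i i' : Fin h, decide ((Fin.castAdd h i : Fin (h + h)) = Fin.natAdd h i') = false := fun i i' =>
    decide_eq_false fun e => by have := congrArg Fin.val e; simp at this; omega
  have hnc : ∀ i i' : Fin h, decide ((Fin.natAdd h i : Fin (h + h)) = Fin.castAdd h i') = false := fun i i' =>
    decide_eq_false fun e => by have := congrArg Fin.val e; simp at this; omega
  have hdual : ∀ i i', decide (Odd #(univ.filter fun j => uf i j && zf i' j)) = decide (i = i') := by
    intro i i'
    induction i using Fin.addCases with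
    | left i =>
      rw [huf, Fin.append_left]
      induction i' using Fin.addCases with
      | left i' =>
        rw [hpc]
        by_cases hii : i = i'
        · subst hii; rw [hbc]; exact (decide_eq_true rfl).symm
        · rw [hbc' i i' hii]; exact (decide_eq_false fun e => hii (Fin.castAdd_inj.mp e)).symm
      | right i' => rw [hpb, hbb, hcn]
    | right i =>
      rw [huf, Fin.append_right]
      induction i' using Fin.addCases with
      | left i' => rw [hpc, hcc, hnc]
      | right i' =>
        rw [hpb, hsymm]
        by_cases hii : i = i'
        · subst hii; rw [hbc]; exact (decide_eq_true rfl).symm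
        · rw [hbc' i' i (Ne.symm hii)]; exact (decide_eq_false fun e => hii (Fin.ext (by have := congrArg Fin.val e; simp only [Fin.val_natAdd] at this; omega))).symm
  have hk : h + h ≤ 7 := tcg_le_of_dual zf uf hdual
  obtain ⟨P, Pi, hPPi, hPiP, hco⟩ := tcg_adapted_frame_le hk zf uf hdual
  refine ⟨h, by omega, P, Pi, hPPi, hPiP, fun s u => ?_⟩
  -- the columns of `P` as bit vectors, and their pairings with the frame
  have hι1 : ∀ x : ZMod 2, (if decide (x = 1) = true then (1 : ZMod 2) else 0) = x := by decide
  have hcol : ∀ s : Fin 7, (fun ψ => decide ((∑ φ, P ψ φ * (if (fun φ' => decide (φ' = s)) φ = true then (1 : ZMod 2) else 0)) = 1)) =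
      fun ψ => decide (P ψ s = 1) := by
    intro s; funext ψ
    have e : (∑ φ, P ψ φ * (if (fun φ' => decide (φ' = s)) φ = true then (1 : ZMod 2) else 0)) = P ψ s := by
      simp only [decide_eq_true_eq, mul_ite, mul_one, mul_zero, Finset.sum_ite_eq', Finset.mem_univ, if_true]
    rw [e]
  have hvc : ∀ (s : Fin 7) (i : Fin h), BX (fun ψ => decide (P ψ s = 1)) (c i) = decide (s.val = i.val) := by
    intro s i
    have e := hco (Fin.castAdd h i) (fun φ' => decide (φ' = s))
    rw [hcol s, hpc] at e
    rw [e]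
    have hv : (Fin.castLE hk (Fin.castAdd h i) = s) ↔ (s.val = i.val) := by
      rw [Fin.ext_iff]; simp only [Fin.val_castLE, Fin.val_castAdd]; exact eq_comm
    simp only [hv]
  have hvb : ∀ (s : Fin 7) (i : Fin h), BX (fun ψ => decide (P ψ s = 1)) (b i) = decide (s.val = h + i.val) := by
    intro s i
    have e := hco (Fin.natAdd h i) (fun φ' => decide (φ' = s))
    rw [hcol s, hpb] at e
    rw [e]
    have hv : (Fin.castLE hk (Fin.natAdd h i) = s) ↔ (s.val = h + i.val) := by
      rw [Fin.ext_iff]; simp only [Fin.val_castLE, Fin.val_natAdd]; exact eq_comm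
    simp only [hv]
  -- expansion along the maximal frame
  have hexp := tsc_form_expansion BX hsymm hadd h b c hbc hbc' hbb hcc hmax (fun ψ => decide (P ψ s = 1)) (fun ψ => decide (P ψ u = 1))
  have hL : (if BX (fun ψ => decide (P ψ s = 1)) (fun ψ => decide (P ψ u = 1)) = true then (1 : ZMod 2) else 0) =
      ∑ m, ∑ m', Ξ m m' * P m s * P m' u := by
    simp only [hBX, hι1]
  rw [← hL, hexp]
  refine sum_congr rfl fun i _ => ?_
  rw [hvc, hvb, hvc, hvb]
  simp only [decide_eq_true_eq]

end Summit.QuantumAdvantage.QuantumAdvantage.Theorems.CubicForrelation.NearExactIsExact
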